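import Summits.AtomisticToContinuum.Crystallization.Theorems.ChargedEnergyGap.Negative.NoBoundaryReduction

/-!
# Crux triage (round 1, triager 3) — certified findings for `LocalToGlobal`
# (item stmt-AtomisticToContinuum-14232, route `PricedLinkCensus`)

1. `isChargeFree_restrict_iff` — BALL LOCALITY OF CHARGE: for `0 ≤ η` and `ρ ≥ 2(1+η)`, the
   charge status of a site `i` of a finite configuration `y` is that of `i` in the
   sub-configuration of the sites within `ρ·nn_i` of `y i` (any index family containing that
   ball).  (The disprover's `isChargeFree_iff_comp_of_far` needs hypothesis H1 at EVERY member of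
   the sub-family, which fails at the rim of a ball; this version has no rim condition.)
2. COSTUME LEMMA for card `flux-cell-joint-census`: its first lemma / transfer
   `FluxCell.LocalPricedGap` (verbatim copy below) is EQUIVALENT to the crux's consequent
   `ChargedEnergyGap` (`localPricedGap_iff_chargedEnergyGap`): `←` with the local functional
   `L env x = e* + κ·𝟙[x is charged in env]` at `ρ₀ = 3` and the landed no-boundary reduction
   `chargedEnergyGap_iff_noBoundary`; `→` by chaining its two inequalities.  So the abstract `∃ L`
   carries no content beyond `ChargedEnergyGap`; the card's content is the CANDIDATE `L`
   (flux cell `T`), which is not in the tree.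
3. `no_conformal_rankOne_connection_twist` — the disprover's twist-wall kernel
   (`no_rankOne_connection_twist`, §4 of `Cruxes/LocalToGlobal/Disproof.lean`) with a FREE
   CONFORMAL FACTOR `μ` (near-similarities of card `cut-and-adapt-envelope` may dilate the two
   grains differently): still no rank-one connection across a twist wall.
-/

noncomputable section

open scoped BigOperators RealInnerProductSpace
open Literature.MathematicalPhysics.StatisticalMechanics Literature.Geometry.DiscreteGeometry
open Summit.AtomisticToContinuum.Crystallization.Theses.PricedLinkCensus
open Summit.AtomisticToContinuum.Crystallization.Theorems.ChargedEnergyGapNegative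

namespace Summit.AtomisticToContinuum.Crystallization.Cruxes.LocalToGlobal.Triage3

/-! ## 1. Ball locality of charge -/

section BallLocality

variable {ι X : Type*} [PseudoMetricSpace X]

/-- Restricting a configuration to a sub-family can only raise nearest-neighbour distances. -/
theorem nearestDist_le_restrict (y : ι → X) (p : ι → Prop) (t : {j // p j})
    (ht : ∃ s : {j // p j}, s ≠ t) :
    nearestDist y t.1 ≤ nearestDist (fun s : {j // p j} => y s.1) t :=
  le_nearestDist ht fun _ hs => nearestDist_le_dist y fun h => hs (Subtype.ext h)

/-- If a `y`-nearest neighbour of `t.1` belongs to the sub-family, the two nearest-neighbour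
distances agree. -/
theorem nearestDist_restrict_eq (y : ι → X) (p : ι → Prop) (t : {j // p j})
    (h : ∃ m : ι, m ≠ t.1 ∧ p m ∧ nearestDist y t.1 = dist (y t.1) (y m)) :
    nearestDist (fun s : {j // p j} => y s.1) t = nearestDist y t.1 := by
  obtain ⟨m, hm, hpm, hd⟩ := h
  have hne : (⟨m, hpm⟩ : {j // p j}) ≠ t := fun h => hm (congrArg Subtype.val h)
  refine le_antisymm ?_ (nearestDist_le_restrict y p t ⟨_, hne⟩)
  rw [hd]
  exact nearestDist_le_dist (fun s : {j // p j} => y s.1) hne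

variable [Finite ι]

/-- **Ball locality of charge.**  Let `0 ≤ η`, `2(1+η) ≤ ρ`, and let `p` be any family of indices
containing every `j` with `dist (y i) (y j) ≤ ρ·nn_i` (in particular `i`).  Then `i` is
charge-free at tolerance `η` in the restricted configuration iff it is in `y`. -/
theorem isChargeFree_restrict_iff {η ρ : ℝ} (hη : 0 ≤ η) (hρ : 2 * (1 + η) ≤ ρ)
    (y : ι → X) (i : ι) (p : ι → Prop)
    (hp : ∀ j, dist (y i) (y j) ≤ ρ * nearestDist y i → p j) (hi : p i) :
    IsChargeFree η (fun s : {j // p j} => y s.1) ⟨i, hi⟩ ↔ IsChargeFree η y i := by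
  set z : {j // p j} → X := fun s => y s.1 with hz
  set i' : {j // p j} := ⟨i, hi⟩ with hi'
  have hη1 : (0 : ℝ) ≤ 1 + η := by linarith
  have hρ1 : (1 : ℝ) ≤ ρ := by linarith
  have hnn : 0 ≤ nearestDist y i := nearestDist_nonneg y i
  by_cases hN : ∃ k, k ≠ i
  swap
  · -- a single site: both sides are false (no neighbours at all)
    push Not at hN
    have h1 : ¬ IsChargeFree η y i := by
      intro h
      have he : (bondGraph η y).neighborSet i = ∅ := by
        ext k
        simp only [SimpleGraph.mem_neighborSet, Set.mem_empty_iff_false, iff_false]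
        exact fun hk => (bondGraph_adj.1 hk).1 (hN k).symm
      have h12 := h.1
      rw [he, Set.ncard_empty] at h12
      exact absurd h12 (by norm_num)
    have h2 : ¬ IsChargeFree η z i' := by
      intro h
      have he : (bondGraph η z).neighborSet i' = ∅ := by
        ext s
        simp only [SimpleGraph.mem_neighborSet, Set.mem_empty_iff_false, iff_false]
        exact fun hs => (bondGraph_adj.1 hs).1 (Subtype.ext (hN s.1)).symm
      have h12 := h.1
      rw [he, Set.ncard_empty] at h12
      exact absurd h12 (by norm_num)
    exact ⟨fun h => (h2 h).elim, fun h => (h1 h).elim⟩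
  -- (a) the nearest neighbour of `i` lies in the ball
  have hnn_i : nearestDist z i' = nearestDist y i := by
    obtain ⟨m, hm, hdm⟩ := exists_nearestDist_eq_dist y hN
    refine nearestDist_restrict_eq y p i' ⟨m, hm, hp m ?_, hdm⟩
    rw [← hdm]
    exact le_mul_of_one_le_left hnn hρ1
  -- (b) sites within `(1+η)·nn_i` of `y i` are in the family, with unchanged `nn`
  have hball : ∀ j, dist (y i) (y j) ≤ (1 + η) * nearestDist y i → p j := by
    intro j hj
    exact hp j (hj.trans (mul_le_mul_of_nonneg_right (by linarith) hnn))
  have hnn_eq : ∀ s : {j // p j}, dist (y i) (y s.1) ≤ (1 + η) * nearestDist y i →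
      nearestDist z s = nearestDist y s.1 := by
    intro s hs
    by_cases hsi : s.1 = i
    · have : s = i' := Subtype.ext hsi
      rw [this]
      exact hnn_i
    obtain ⟨m, hm, hdm⟩ := exists_nearestDist_eq_dist y ⟨i, Ne.symm hsi⟩
    refine nearestDist_restrict_eq y p s ⟨m, hm, hp m ?_, hdm⟩
    have h1 : nearestDist y s.1 ≤ dist (y s.1) (y i) := nearestDist_le_dist y (Ne.symm hsi)
    rw [dist_comm] at h1
    calc dist (y i) (y m) ≤ dist (y i) (y s.1) + dist (y s.1) (y m) := dist_triangle _ _ _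
      _ = dist (y i) (y s.1) + nearestDist y s.1 := by rw [hdm]
      _ ≤ (1 + η) * nearestDist y i + (1 + η) * nearestDist y i := by linarith
      _ = 2 * (1 + η) * nearestDist y i := by ring
      _ ≤ ρ * nearestDist y i := mul_le_mul_of_nonneg_right hρ hnn
  -- (c) bonds at `i` are the same in `y` and in `z`
  have hadj_i : ∀ s : {j // p j}, (bondGraph η y).Adj i s.1 ↔ (bondGraph η z).Adj i' s := by
    intro s
    rw [bondGraph_adj, bondGraph_adj]
    constructor
    · rintro ⟨hne, hle⟩
      have hd : dist (y i) (y s.1) ≤ (1 + η) * nearestDist y i :=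
        hle.trans (mul_le_mul_of_nonneg_left (min_le_left _ _) hη1)
      refine ⟨fun h => hne (congrArg Subtype.val h), ?_⟩
      show dist (y i) (y s.1) ≤ (1 + η) * min (nearestDist z i') (nearestDist z s)
      rw [hnn_i, hnn_eq s hd]
      exact hle
    · rintro ⟨hne, hle⟩
      change dist (y i) (y s.1) ≤ (1 + η) * min (nearestDist z i') (nearestDist z s) at hle
      rw [hnn_i] at hle
      have hd : dist (y i) (y s.1) ≤ (1 + η) * nearestDist y i :=
        hle.trans (mul_le_mul_of_nonneg_left (min_le_left _ _) hη1)
      rw [hnn_eq s hd] at hle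
      exact ⟨fun h => hne (Subtype.ext h), hle⟩
  -- a bond at `i` lands in the family
  have hmem : ∀ k, (bondGraph η y).Adj i k → p k := fun k hk =>
    hball k ((bondGraph_adj.1 hk).2.trans (mul_le_mul_of_nonneg_left (min_le_left _ _) hη1))
  -- (d) bonds between two neighbours of `i` are the same in `y` and in `z`
  have hadj_jk : ∀ s t : {j // p j}, (bondGraph η y).Adj i s.1 → (bondGraph η y).Adj i t.1 →
      ((bondGraph η y).Adj s.1 t.1 ↔ (bondGraph η z).Adj s t) := by
    intro s t hs ht
    have hds : dist (y i) (y s.1) ≤ (1 + η) * nearestDist y i :=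
      (bondGraph_adj.1 hs).2.trans (mul_le_mul_of_nonneg_left (min_le_left _ _) hη1)
    have hdt : dist (y i) (y t.1) ≤ (1 + η) * nearestDist y i :=
      (bondGraph_adj.1 ht).2.trans (mul_le_mul_of_nonneg_left (min_le_left _ _) hη1)
    rw [bondGraph_adj, bondGraph_adj]
    change _ ↔ (s ≠ t ∧ dist (y s.1) (y t.1) ≤ (1 + η) * min (nearestDist z s) (nearestDist z t))
    rw [hnn_eq s hds, hnn_eq t hdt]
    exact ⟨fun ⟨hne, hle⟩ => ⟨fun h => hne (congrArg Subtype.val h), hle⟩,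
      fun ⟨hne, hle⟩ => ⟨fun h => hne (Subtype.ext h), hle⟩⟩
  -- (e) neighbour sets and common-neighbour sets correspond under `Subtype.val`
  have hNi : (bondGraph η y).neighborSet i = Subtype.val '' (bondGraph η z).neighborSet i' := by
    ext k
    simp only [SimpleGraph.mem_neighborSet, Set.mem_image]
    constructor
    · intro hk
      exact ⟨⟨k, hmem k hk⟩, (hadj_i ⟨k, hmem k hk⟩).1 hk, rfl⟩
    · rintro ⟨s, hs, rfl⟩
      exact (hadj_i s).2 hs
  have hNN : ∀ s : {j // p j}, (bondGraph η z).Adj i' s →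
      (bondGraph η y).neighborSet i ∩ (bondGraph η y).neighborSet s.1 =
        Subtype.val '' ((bondGraph η z).neighborSet i' ∩ (bondGraph η z).neighborSet s) := by
    intro s hs
    have hs' : (bondGraph η y).Adj i s.1 := (hadj_i s).2 hs
    ext k
    simp only [Set.mem_inter_iff, SimpleGraph.mem_neighborSet, Set.mem_image]
    constructor
    · rintro ⟨hik, hsk⟩
      exact ⟨⟨k, hmem k hik⟩, ⟨(hadj_i ⟨k, hmem k hik⟩).1 hik,
        (hadj_jk s ⟨k, hmem k hik⟩ hs' hik).1 hsk⟩, rfl⟩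
    · rintro ⟨t, ⟨hit, hst⟩, rfl⟩
      have hit' : (bondGraph η y).Adj i t.1 := (hadj_i t).2 hit
      exact ⟨hit', (hadj_jk s t hs' hit').2 hst⟩
  -- (f) assemble
  have hinj : Function.Injective (Subtype.val : {j // p j} → ι) := Subtype.val_injective
  rw [isChargeFree_iff, isChargeFree_iff, hNi, Set.ncard_image_of_injective _ hinj]
  refine and_congr_right fun _ => ⟨fun H k hk => ?_, fun H s hs => ?_⟩
  · obtain ⟨s, hs, rfl⟩ := hk
    rw [ringNumber_def, hNN s hs, Set.ncard_image_of_injective _ hinj, ← ringNumber_def]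
    exact H s hs
  · have h4 := H s.1 ⟨s, hs, rfl⟩
    rw [ringNumber_def, hNN s hs, Set.ncard_image_of_injective _ hinj, ← ringNumber_def] at h4
    exact h4

end BallLocality

/-! ## 2. The costume lemma for `flux-cell-joint-census` -/

/-- verbatim copy of `…Cruxes.LocalToGlobal.FluxCell.LocalPricedGap` (SketchIdeator1.lean), the
card's first lemma / transfer `C⁺`. -/
def LocalPricedGap : Prop :=
  ∃ (ρ₀ κ C : ℝ) (L : Finset E3 → E3 → ℝ), 0 < κ ∧
    ∀ (N : ℕ) (y : Fin N → E3), Function.Injective y →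
      (N : ℝ) * (⨅ Q : PeriodicConfiguration 3, Q.energyPerParticle lennardJones) +
            κ * (Nat.card {i : Fin N // ¬ IsChargeFree (1 / 100 : ℝ) y i} : ℝ) -
            C * (N : ℝ) ^ (2 / 3 : ℝ) ≤
          ∑ i, L ((Finset.univ.filter fun j => dist (y i) (y j) ≤ ρ₀ * nearestDist y i).image y) (y i) ∧
      ∑ i, L ((Finset.univ.filter fun j => dist (y i) (y j) ≤ ρ₀ * nearestDist y i).image y) (y i) ≤
          interactionEnergy lennardJones y

/-- `LocalPricedGap → ChargedEnergyGap` (the sketch's two-line reduction, re-proved on the copy). -/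
theorem chargedEnergyGap_of_localPricedGap (h : LocalPricedGap) : ChargedEnergyGap := by
  obtain ⟨ρ₀, κ, C, L, hκ, h⟩ := h
  exact ⟨κ, C, hκ, fun N y hy => le_trans (h N y hy).1 (h N y hy).2⟩

/-- "`x` is a charged site of the finite point set `S`" (false if `x ∉ S`). -/
def ChargedIn (S : Finset E3) (x : E3) : Prop :=
  ∃ h : x ∈ S, ¬ IsChargeFree (1 / 100 : ℝ) (fun q : {q : E3 // q ∈ S} => q.1) ⟨x, h⟩

open Classical in
/-- THE COSTUME FUNCTIONAL `L env x = e + κ·𝟙[x charged in env]`. -/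
def costumeL (e κ : ℝ) (S : Finset E3) (x : E3) : ℝ :=
  e + κ * (if ChargedIn S x then 1 else 0)

/-- the radius-`3` environment of site `i`, as the card reads it. -/
def env {N : ℕ} (y : Fin N → E3) (i : Fin N) : Finset E3 :=
  (Finset.univ.filter fun j => dist (y i) (y j) ≤ 3 * nearestDist y i).image y

/-- **Charge read in the radius-3 environment = charge in the configuration.** -/
theorem chargedIn_env_iff {N : ℕ} (y : Fin N → E3) (hy : Function.Injective y) (i : Fin N) :
    ChargedIn (env y i) (y i) ↔ ¬ IsChargeFree (1 / 100 : ℝ) y i := by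
  set p : Fin N → Prop := fun j => dist (y i) (y j) ≤ 3 * nearestDist y i with hp
  have hi : p i := by
    show dist (y i) (y i) ≤ 3 * nearestDist y i
    rw [dist_self]
    exact mul_nonneg (by norm_num) (nearestDist_nonneg y i)
  have hmemS : ∀ s : {j // p j}, y s.1 ∈ env y i := fun s =>
    Finset.mem_image_of_mem y (Finset.mem_filter.2 ⟨Finset.mem_univ _, s.2⟩)
  let f : {j // p j} → {q : E3 // q ∈ env y i} := fun s => ⟨y s.1, hmemS s⟩
  have hf : Function.Bijective f := by
    constructor
    · intro s t hst
      exact Subtype.ext (hy (congrArg Subtype.val hst))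
    · rintro ⟨q, hq⟩
      obtain ⟨j, hj, rfl⟩ := Finset.mem_image.1 hq
      exact ⟨⟨j, (Finset.mem_filter.1 hj).2⟩, rfl⟩
  let eT : {j // p j} ≃ {q : E3 // q ∈ env y i} := Equiv.ofBijective f hf
  have hloc := isChargeFree_restrict_iff (η := 1 / 100) (ρ := 3) (by norm_num) (by norm_num)
    y i p (fun j hj => hj) hi
  have hequiv := isChargeFree_comp_equiv_iff (1 / 100 : ℝ)
    (fun q : {q : E3 // q ∈ env y i} => q.1) eT ⟨i, hi⟩
  have hcomp : ((fun q : {q : E3 // q ∈ env y i} => q.1) ∘ eT) = fun s : {j // p j} => y s.1 := by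
    funext s
    rfl
  rw [hcomp] at hequiv
  have heT : eT ⟨i, hi⟩ = ⟨y i, hmemS ⟨i, hi⟩⟩ := rfl
  rw [heT] at hequiv
  -- hequiv : IsChargeFree (1/100) (fun s => y s.1) ⟨i, hi⟩ ↔ IsChargeFree (1/100) (·.1) ⟨y i, _⟩
  constructor
  · rintro ⟨hmem, hch⟩ hcf
    exact hch (hequiv.1 (hloc.2 hcf))
  · intro hncf
    exact ⟨hmemS ⟨i, hi⟩, fun hcf => hncf (hloc.1 (hequiv.2 hcf))⟩

/-- **The costume functional sums to `N e + κ·#charged`.** -/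
theorem sum_costumeL {N : ℕ} (y : Fin N → E3) (hy : Function.Injective y) (e κ : ℝ) :
    ∑ i, costumeL e κ (env y i) (y i) =
      (N : ℝ) * e + κ * (Nat.card {i : Fin N // ¬ IsChargeFree (1 / 100 : ℝ) y i} : ℝ) := by
  classical
  have h1 : ∀ i, costumeL e κ (env y i) (y i) =
      e + κ * (if ¬ IsChargeFree (1 / 100 : ℝ) y i then 1 else 0) := by
    intro i
    unfold costumeL
    rw [if_congr (chargedIn_env_iff y hy i) rfl rfl]
  simp_rw [h1]
  rw [Finset.sum_add_distrib, Finset.sum_const, Finset.card_univ, Fintype.card_fin, nsmul_eq_mul,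
    ← Finset.mul_sum, Finset.sum_boole, Nat.card_eq_fintype_card, Fintype.card_subtype]

/-- **`ChargedEnergyGap → LocalPricedGap`** with the costume functional at `ρ₀ = 3`, `C = 0`
(via the landed no-boundary reduction `chargedEnergyGap_iff_noBoundary`). -/
theorem localPricedGap_of_chargedEnergyGap (h : ChargedEnergyGap) : LocalPricedGap := by
  obtain ⟨κ, hκ, h⟩ := chargedEnergyGap_iff_noBoundary.1 h
  refine ⟨3, κ, 0, costumeL eStar κ, hκ, fun N y hy => ?_⟩
  have hs : ∑ i, costumeL eStar κ
      ((Finset.univ.filter fun j => dist (y i) (y j) ≤ 3 * nearestDist y i).image y) (y i) =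
      (N : ℝ) * eStar + κ * (Nat.card {i : Fin N // ¬ IsChargeFree (1 / 100 : ℝ) y i} : ℝ) :=
    sum_costumeL y hy eStar κ
  rw [hs]
  refine ⟨?_, h N y hy⟩
  simp [eStar]

/-- **COSTUME: the card's `C⁺` is the consequent.** -/
theorem localPricedGap_iff_chargedEnergyGap : LocalPricedGap ↔ ChargedEnergyGap :=
  ⟨chargedEnergyGap_of_localPricedGap, localPricedGap_of_chargedEnergyGap⟩

/-- … and therefore proves the crux exactly when the consequent is proved outright. -/
theorem localToGlobal_of_localPricedGap (h : LocalPricedGap) : LocalToGlobal :=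
  fun _ => chargedEnergyGap_of_localPricedGap h

/-! ## 3. The twist-wall kernel with a free conformal factor -/

/-- coordinate unit vectors (copy of the disprover's `ee`). -/
def ee (i : Fin 3) : E3 := EuclideanSpace.single i 1

/-- the uniaxial stretch `U_{α,c} v = v + α ⟪c, v⟫ c` (copy of the disprover's `uniax`). -/
def uniax (α : ℝ) (c v : E3) : E3 := v + (α * ⟪c, v⟫) • c

/-- the two `c`-axes of a bicrystal, rotated against each other about `e₁` (copies). -/
def cPlus (p q : ℝ) : E3 := p • ee 0 + q • ee 2
def cMinus (p q : ℝ) : E3 := p • ee 0 - q • ee 2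

@[simp] theorem inner_ee (i j : Fin 3) : ⟪ee i, ee j⟫ = if i = j then (1 : ℝ) else 0 := by
  by_cases h : i = j
  · subst h; simp [ee]
  · simp [ee, h, EuclideanSpace.inner_single_left]

/-- **Twist-wall incompatibility with a free conformal factor.**  Even allowing the two grains to be
dilated differently (factor `μ`, any real), the uniaxially adapted wells `U₊ = U_{α,c₊}`,
`U₋ = U_{α,c₋}` admit no rank-one connection `μ Q U₊ − U₋ = a ⊗ e₁` across the TWIST normal `e₁`
(`Q` a linear isometry): testing on `e₀, e₂ ⊥ e₁` gives `μ Q U₊ e₀ = U₋ e₀`, `μ Q U₊ e₂ = U₋ e₂`,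
whence `μ² ⟪U₊e₀, U₊e₂⟫ = ⟪U₋e₀, U₋e₂⟫ = −⟪U₊e₀, U₊e₂⟫` with `⟪U₊e₀, U₊e₂⟫ = αpq(2 + α(p²+q²)) > 0`. -/
theorem no_conformal_rankOne_connection_twist {α p q : ℝ} (hα : 0 < α) (hp : 0 < p) (hq : 0 < q) :
    ¬ ∃ (μ : ℝ) (Q : E3 →ₗᵢ[ℝ] E3) (a : E3), ∀ v : E3,
        μ • Q (uniax α (cPlus p q) v) - uniax α (cMinus p q) v = ⟪ee 1, v⟫ • a := by
  rintro ⟨μ, Q, a, h⟩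
  have h0 := h (ee 0)
  have h2 := h (ee 2)
  simp only [inner_ee] at h0 h2
  simp at h0 h2
  have e0 : μ • Q (uniax α (cPlus p q) (ee 0)) = uniax α (cMinus p q) (ee 0) := sub_eq_zero.1 h0
  have e2 : μ • Q (uniax α (cPlus p q) (ee 2)) = uniax α (cMinus p q) (ee 2) := sub_eq_zero.1 h2
  have key : μ ^ 2 * ⟪uniax α (cPlus p q) (ee 0), uniax α (cPlus p q) (ee 2)⟫ =
      ⟪uniax α (cMinus p q) (ee 0), uniax α (cMinus p q) (ee 2)⟫ := by
    rw [← e0, ← e2, real_inner_smul_left, real_inner_smul_right, LinearIsometry.inner_map_map]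
    ring
  simp only [uniax, cPlus, cMinus, inner_add_left, inner_add_right, inner_sub_left, inner_sub_right,
    inner_smul_left, inner_smul_right, inner_ee] at key
  simp at key
  have hG : 0 < α * p * q * (2 + α * (p ^ 2 + q ^ 2)) := by positivity
  nlinarith [hG, sq_nonneg μ, mul_nonneg (sq_nonneg μ) hG.le, mul_pos hp hq,
    mul_pos (mul_pos hα hp) hq]

end Summit.AtomisticToContinuum.Crystallization.Cruxes.LocalToGlobal.Triage3

end
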